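import Mathlib
import Literature.Computability.AlgebraicComplexity.NewtonPolygonTauBounds
import Summits.ValiantsHypothesis.ValiantsHypothesis.Theses.NewtonUnitEquations

/-!
# `BeatTwoThirds_special` — F3 WITNESS for line `slope-ladder` (crux `NewtonUnitEquations.NewtonTauWeak`, stmt-ValiantsHypothesis-5904)

Self-contained, sorry-free: the rung family `SlopeBound c` (verbatim from `Lines/slope_ladder.lean`) SPECIALISES TO THE PROVED
FLOOR `c = 2/3` — KPTT Theorem 6 (`Literature.Computability.AlgebraicComplexity.KPTT.theorem6_holds`, proved in the tree from the
Eisenbrand–Pach–Rothvoß–Sopher theorem, `NewtonPolygonTauBounds.lean`) for `m ≥ 2`, support counting for `m ≤ 1`.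
The rung `BeatTwoThirds := ∃ c < 2/3, SlopeBound c` is the floor with ONE parameter moved (the slope, strictly); `floor → rung`
does not close (probe P6/P7 in the planner's `bc/BeatTwoThirds_probe.lean`: unsolved goals), `NewtonTauWeak → rung` is proved in the
line file (`beatTwoThirds_of_newtonTauWeak`).  witness_regime: all sums of products of sparse bivariate polynomials over ℂ (no
restriction on k, m, t); S (= VP ≠ VNP, and the crux) NOT known there.
[cite: KoiranPortierTavenasThomasse2015, Theorem 6; doi:10.37236/883 (EPRS08), Theorem 1]
-/

set_option linter.dupNamespace false

namespace Summit.ValiantsHypothesis.ValiantsHypothesis.Cruxes.NewtonTauWeak.SlopeLadder.Special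

open scoped BigOperators Pointwise
open MvPolynomial
open Literature.Computability.AlgebraicComplexity (newtonVertexCount)
open Literature.Computability.AlgebraicComplexity.KPTT (theorem6 theorem6_holds card_support_prod_univ_le_pow)
open Summit.ValiantsHypothesis.ValiantsHypothesis.Theses.NewtonUnitEquations (NewtonTauWeak)

noncomputable section

/-- SLOPE-`c` BOUND: `vert(Σ_{i<k} Π_{j<m} f_ij) ≤ C (k+2)^b 2^{bm} (t+2)^b (t+2)^{c m}` for `t`-sparse bivariate `f_ij`
over `ℂ` (`newtonVertexCount` is the crux's literal vertex count).  Slope `1` trivial, slope `2/3` = KPTT Thm 6 (floor),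
slope `0` ⟸ the crux. Monotone in `c` (`slopeBound_mono`). -/
def SlopeBound (c : ℝ) : Prop :=
  ∃ (C : ℝ) (b : ℕ), ∀ (k m t : ℕ) (f : Fin k → Fin m → MvPolynomial (Fin 2) ℂ),
    (∀ i j, (f i j).support.card ≤ t) →
      (newtonVertexCount (∑ i, ∏ j, f i j) : ℝ) ≤
        C * ((k : ℝ) + 2) ^ b * 2 ^ (b * m) * ((t : ℝ) + 2) ^ b * ((t : ℝ) + 2) ^ (c * (m : ℝ))

/-- THE RUNG (this line's target): beat the Eisenbrand–Pach–Rothvoß–Sopher / KPTT slope `2/3` by a fixed amount. -/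
def BeatTwoThirds : Prop := ∃ c : ℝ, c < 2 / 3 ∧ SlopeBound c

/-- The Newton vertex count is at most the number of monomials. [folklore] -/
theorem newtonVertexCount_le_card (p : MvPolynomial (Fin 2) ℂ) : newtonVertexCount p ≤ p.support.card := by
  classical
  calc newtonVertexCount p
      ≤ ((fun e : Fin 2 →₀ ℕ => fun i : Fin 2 => ((e i : ℕ) : ℝ)) '' (p.support : Set (Fin 2 →₀ ℕ))).ncard :=
        Set.ncard_le_ncard extremePoints_convexHull_subset ((p.support.finite_toSet).image _)
    _ ≤ (p.support : Set (Fin 2 →₀ ℕ)).ncard := Set.ncard_image_le p.support.finite_toSet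
    _ = p.support.card := Set.ncard_coe_finset _

/-- `Σ_{i<k} Π_{j<m} f_ij` with `t`-sparse factors has at most `k t^m` monomials. [folklore; KPTT §2] -/
theorem card_support_sum_prod_le {k m t : ℕ} (f : Fin k → Fin m → MvPolynomial (Fin 2) ℂ)
    (hf : ∀ i j, (f i j).support.card ≤ t) : (∑ i, ∏ j, f i j).support.card ≤ k * t ^ m := by
  classical
  calc (∑ i, ∏ j, f i j).support.card
      ≤ (Finset.univ.biUnion fun i => (∏ j, f i j).support).card := Finset.card_le_card MvPolynomial.support_sum
    _ ≤ ∑ i, (∏ j, f i j).support.card := Finset.card_biUnion_le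
    _ ≤ ∑ _i : Fin k, t ^ m := Finset.sum_le_sum fun i _ => card_support_prod_univ_le_pow (f i) (hf i)
    _ = k * t ^ m := by simp

/-- The trivial vertex bound `vert ≤ k t^m` (slope `1`). [KPTT §2] -/
theorem newtonVertexCount_sum_prod_le {k m t : ℕ} (f : Fin k → Fin m → MvPolynomial (Fin 2) ℂ)
    (hf : ∀ i j, (f i j).support.card ≤ t) : newtonVertexCount (∑ i, ∏ j, f i j) ≤ k * t ^ m :=
  (newtonVertexCount_le_card _).trans (card_support_sum_prod_le f hf)

/-- **THE FLOOR (F3 witness).** Slope `2/3` holds: KPTT Theorem 6 (`KPTT.theorem6_holds`, proved in the tree from the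
Eisenbrand–Pach–Rothvoß–Sopher theorem `KPTT.card_le_of_convexIndependent_subset_add`) for `m ≥ 2`, support counting for `m ≤ 1`. -/
theorem slopeBound_two_thirds : SlopeBound (2 / 3) := by
  obtain ⟨C, hC⟩ := theorem6_holds
  refine ⟨max C 1, 1, fun k m t f hf => ?_⟩
  have hk0 : (0 : ℝ) ≤ k := Nat.cast_nonneg k
  have ht0 : (0 : ℝ) ≤ t := Nat.cast_nonneg t
  have ht1 : (1 : ℝ) ≤ (t : ℝ) + 2 := by linarith
  have hM1 : (1 : ℝ) ≤ max C 1 := le_max_right _ _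
  have hT1 : (1 : ℝ) ≤ ((t : ℝ) + 2) ^ (2 / 3 * (m : ℝ)) := Real.one_le_rpow ht1 (by positivity)
  have h2m : (1 : ℝ) ≤ 2 ^ (1 * m) := one_le_pow₀ (by norm_num)
  have ht21 : (1 : ℝ) ≤ ((t : ℝ) + 2) ^ 1 := by rw [pow_one]; exact ht1
  by_cases hm : 2 ≤ m
  · -- KPTT Theorem 6
    have h6 : (newtonVertexCount (∑ i, ∏ j, f i j) : ℝ) ≤ C * k * (t : ℝ) ^ (2 * (m : ℝ) / 3) :=
      hC ℂ k m t f hm hf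
    have hT : (t : ℝ) ^ (2 * (m : ℝ) / 3) ≤ ((t : ℝ) + 2) ^ (2 / 3 * (m : ℝ)) := by
      rw [show (2 * (m : ℝ) / 3) = 2 / 3 * (m : ℝ) by ring]
      exact Real.rpow_le_rpow ht0 (by linarith) (by positivity)
    calc (newtonVertexCount (∑ i, ∏ j, f i j) : ℝ)
        ≤ C * k * (t : ℝ) ^ (2 * (m : ℝ) / 3) := h6
      _ ≤ max C 1 * k * (t : ℝ) ^ (2 * (m : ℝ) / 3) := by gcongr; exact le_max_left _ _
      _ ≤ max C 1 * ((k : ℝ) + 2) * ((t : ℝ) + 2) ^ (2 / 3 * (m : ℝ)) := by gcongr; linarith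
      _ = max C 1 * ((k : ℝ) + 2) * ((t : ℝ) + 2) ^ (2 / 3 * (m : ℝ)) * 1 := (mul_one _).symm
      _ ≤ max C 1 * ((k : ℝ) + 2) * ((t : ℝ) + 2) ^ (2 / 3 * (m : ℝ)) * (2 ^ (1 * m) * ((t : ℝ) + 2) ^ 1) := by
          gcongr
          exact one_le_mul_of_one_le_of_one_le h2m ht21
      _ = max C 1 * ((k : ℝ) + 2) ^ 1 * 2 ^ (1 * m) * ((t : ℝ) + 2) ^ 1 * ((t : ℝ) + 2) ^ (2 / 3 * (m : ℝ)) := by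
          ring
  · -- m ≤ 1: support counting
    have hnat : newtonVertexCount (∑ i, ∏ j, f i j) ≤ (k + 2) * (t + 2) := by
      refine (newtonVertexCount_sum_prod_le f hf).trans ?_
      rcases (show m = 0 ∨ m = 1 by omega) with rfl | rfl
      · simp only [pow_zero, mul_one]; nlinarith
      · simp only [pow_one]; nlinarith
    have hreal : (newtonVertexCount (∑ i, ∏ j, f i j) : ℝ) ≤ ((k : ℝ) + 2) * ((t : ℝ) + 2) := by
      exact_mod_cast hnat
    calc (newtonVertexCount (∑ i, ∏ j, f i j) : ℝ)
        ≤ ((k : ℝ) + 2) * ((t : ℝ) + 2) := hreal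
      _ = ((k : ℝ) + 2) * ((t : ℝ) + 2) * 1 := (mul_one _).symm
      _ ≤ ((k : ℝ) + 2) * ((t : ℝ) + 2) * (max C 1 * 2 ^ (1 * m) * ((t : ℝ) + 2) ^ (2 / 3 * (m : ℝ))) := by
          gcongr
          exact one_le_mul_of_one_le_of_one_le (one_le_mul_of_one_le_of_one_le hM1 h2m) hT1
      _ = max C 1 * ((k : ℝ) + 2) ^ 1 * 2 ^ (1 * m) * ((t : ℝ) + 2) ^ 1 * ((t : ℝ) + 2) ^ (2 / 3 * (m : ℝ)) := by
          ring

/-- **F3 witness**: the rung family at the floor parameter is a theorem. -/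
example : SlopeBound (2 / 3) := slopeBound_two_thirds

/-- The floor sits inside the rung's existential range only at the excluded endpoint: `BeatTwoThirds` asks for `c < 2/3`. -/
example : ¬ ((2 : ℝ) / 3 < 2 / 3) := lt_irrefl _

end

end Summit.ValiantsHypothesis.ValiantsHypothesis.Cruxes.NewtonTauWeak.SlopeLadder.Special
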